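import Summits.QuantumFields.YangMills.Theorems.SwapVirialDeficitZeroModeSigmaFourSmallBallRateBlocks
import HarnessLib

/-!
# Exact zero-mode rung Z5 — toward the POWER RATE of the σ-twisted four-leader small ball, measure side VII-a: the weighted hub integral
# (free-hands support of ⟨stmt-QuantumFields-24197⟩; split with w3 g63: deterministic Taylor package ✓`…SmallBallTaylor`, measure side w2 g56)

The Markov and layer pieces of the per-hub bound (part VI) carry the transverse moment cost `(4/(α²β⁴))^p` times the block constant
`hubK(α,β)·I(1/3)²`; at the hub `a` of the cone model (`α² = a₀²/‖a‖²`, `β² = ‖Im a‖²/‖a‖²`, ✓`axisUnit_sq`) this is at most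
`4^p(π²/12)·(a₀²)^{−(1/3+p)}·(‖Im a‖²)^{−(4/3+2p)}`, which is cone-integrable for `p < 1/12`:
* §P ★ `lintegral_ball_singPow2_lt_top` — `∫_B (a₀²)^{−c₁}(‖Im a‖²)^{−c₂} < ∞` for `2c₁ < 1`, `2c₂/3 < 1` (AM–GM ✓`rpow_neg_sum_three_le`, four ✓`Ising`'s;
  w3 g63's ✓`lintegral_ball_hubW_lt_top` is `c₁ = 1/3`, `c₂ = 4/3`), `lintegral_cone_singPow2_lt_top`;
* §Q ★ `moment_hubK_le` / `ofReal_moment_hubK_le` — the weight bound above (real and `⊤`-valued forms).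
HONEST LABEL: finite-dimensional real analysis (plan-level zero-mode rung of a DRAFT line «sharp-sigma»); NOT the fixed-`L` sharp law, NOT ⟨24197⟩; the
Yang–Mills mass gap is NOT proved; no summit is proved by a line.  Width seat ym-line-sfw-p2-w2 g56 (cell ym-idea-1, free hands; own crux ⟨22884⟩ blocked-on ⟨19935⟩),
`--supports stmt-QuantumFields-24197`.  THEOREMS ONLY, standard axioms, 0 `sorry`.  References: [cite: Luscher1983, §2]; [cite: Vanbaal2001]; [folklore].
-/

set_option autoImplicit false

noncomputable section

open MeasureTheory Quaternion Set Filter Topology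
open scoped Quaternion ENNReal BigOperators
open Literature.MathematicalPhysics.QuantumLattice
open Literature.Analysis.Calculus (radialUnit radialUnit_def norm_radialUnit)
open Summit.QuantumFields.YangMills.Theorems.SwapTwistDeficit.ToronLog
open Summit.QuantumFields.YangMills.Theorems.SwapVirialDeficit.ZeroModeGroup

attribute [local instance] Literature.Analysis.FluidPDE.Tao2016.quatMeasurableSpace
  Literature.Analysis.FluidPDE.Tao2016.quatBorelSpace

namespace Summit.QuantumFields.YangMills.Theorems.SwapVirialDeficit.ZeroModeSigma

/-! ## §P The two-exponent singular weight is integrable on the unit ball -/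

/-- ★ **`∫_B (a₀²)^{−c₁}·(‖Im a‖²)^{−c₂} da < ∞`** for `0 < c₁`, `2c₁ < 1`, `0 < c₂`, `2c₂/3 < 1` (the `⊤`-valued weights ✓`singPow`; AM–GM on `‖Im a‖²`).
[folklore] -/
theorem lintegral_ball_singPow2_lt_top {c₁ c₂ : ℝ} (hc1 : 0 < c₁) (hc1' : 2 * c₁ < 1) (hc2 : 0 < c₂) (hc2' : 2 * (c₂ / 3) < 1) :
    ∫⁻ a : ℍ, (Metric.ball (0:ℍ) 1).indicator (fun a => singPow c₁ a.re * singPow c₂ ‖a.im‖) a < ∞ := by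
  set B : Set (ℝ × (ℝ × (ℝ × ℝ))) := {p | p.1 ^ 2 + p.2.1 ^ 2 + p.2.2.1 ^ 2 + p.2.2.2 ^ 2 < 1} with hB
  set f : ℝ × (ℝ × (ℝ × ℝ)) → ℝ≥0∞ := fun p => B.indicator
      (fun p => singPow c₁ p.1 * singPow c₂ (Real.sqrt (p.2.1 ^ 2 + p.2.2.1 ^ 2 + p.2.2.2 ^ 2))) p with hf
  have hBm : MeasurableSet B := measurableSet_lt (by fun_prop) measurable_const
  have hfm : Measurable f :=
    (((measurable_singPow _).comp measurable_fst).mul ((measurable_singPow _).comp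
      ((by fun_prop : Measurable fun p : ℝ × (ℝ × (ℝ × ℝ)) => p.2.1 ^ 2 + p.2.2.1 ^ 2 + p.2.2.2 ^ 2).sqrt))).indicator hBm
  have him_eq : ∀ a : ℍ, ‖a.im‖ = Real.sqrt (a.imI ^ 2 + a.imJ ^ 2 + a.imK ^ 2) := by
    intro a
    have h : ‖a.im‖ ^ 2 = a.imI ^ 2 + a.imJ ^ 2 + a.imK ^ 2 := by rw [sq_norm_eq_sum_sq]; simp
    rw [← h, Real.sqrt_sq (norm_nonneg _)]
  have he : ∀ a : ℍ, (Metric.ball (0:ℍ) 1).indicator (fun a => singPow c₁ a.re * singPow c₂ ‖a.im‖) a = f (coord4 a) := by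
    intro a
    have hmem : a ∈ Metric.ball (0:ℍ) 1 ↔ coord4 a ∈ B := by
      show a ∈ Metric.ball (0:ℍ) 1 ↔ a.re ^ 2 + a.imI ^ 2 + a.imJ ^ 2 + a.imK ^ 2 < 1
      rw [Metric.mem_ball, dist_zero_right, ← sq_norm_eq_sum_sq, pow_lt_one_iff_of_nonneg (norm_nonneg _) two_ne_zero]
    simp only [hf]
    by_cases hm : a ∈ Metric.ball (0:ℍ) 1
    · rw [indicator_of_mem hm, indicator_of_mem (hmem.1 hm), him_eq]; rfl
    · rw [indicator_of_notMem hm, indicator_of_notMem (fun h => hm (hmem.2 h))]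
  rw [lintegral_congr he, measurePreserving_coord4.lintegral_comp hfm]
  have hC : ENNReal.ofReal ((3:ℝ) ^ (-c₂)) ≠ 0 := (ENNReal.ofReal_pos.2 (Real.rpow_pos_of_pos (by norm_num) _)).ne'
  have hbd : ∀ p, f p ≤ ENNReal.ofReal ((3:ℝ) ^ (-c₂)) * ({u : ℝ | u ^ 2 < 1}.indicator (singPow c₁) p.1 *
      ({u : ℝ | u ^ 2 < 1}.indicator (singPow (c₂ / 3)) p.2.1 * ({u : ℝ | u ^ 2 < 1}.indicator (singPow (c₂ / 3)) p.2.2.1 *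
        {u : ℝ | u ^ 2 < 1}.indicator (singPow (c₂ / 3)) p.2.2.2))) := by
    intro p
    by_cases hm : p ∈ B
    swap
    · simp only [hf]; rw [indicator_of_notMem hm]; exact bot_le
    have hm' : p.1 ^ 2 + p.2.1 ^ 2 + p.2.2.1 ^ 2 + p.2.2.2 ^ 2 < 1 := hm
    have h0 : p.1 ∈ {u : ℝ | u ^ 2 < 1} := by
      show p.1 ^ 2 < 1; nlinarith [sq_nonneg p.2.1, sq_nonneg p.2.2.1, sq_nonneg p.2.2.2]
    have h1 : p.2.1 ∈ {u : ℝ | u ^ 2 < 1} := by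
      show p.2.1 ^ 2 < 1; nlinarith [sq_nonneg p.1, sq_nonneg p.2.2.1, sq_nonneg p.2.2.2]
    have h2 : p.2.2.1 ∈ {u : ℝ | u ^ 2 < 1} := by
      show p.2.2.1 ^ 2 < 1; nlinarith [sq_nonneg p.1, sq_nonneg p.2.1, sq_nonneg p.2.2.2]
    have h3 : p.2.2.2 ∈ {u : ℝ | u ^ 2 < 1} := by
      show p.2.2.2 ^ 2 < 1; nlinarith [sq_nonneg p.1, sq_nonneg p.2.1, sq_nonneg p.2.2.1]
    simp only [hf]
    rw [indicator_of_mem hm, indicator_of_mem h0, indicator_of_mem h1, indicator_of_mem h2, indicator_of_mem h3]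
    by_cases z0 : p.1 = 0
    · rw [z0, singPow_zero, ENNReal.top_mul (mul_ne_zero (singPow_ne_zero _ _) (mul_ne_zero (singPow_ne_zero _ _) (singPow_ne_zero _ _))),
        ENNReal.mul_top hC]
      exact le_top
    by_cases z1 : p.2.1 = 0
    · rw [z1, singPow_zero, ENNReal.top_mul (mul_ne_zero (singPow_ne_zero _ _) (singPow_ne_zero _ _)), ENNReal.mul_top (singPow_ne_zero _ _),
        ENNReal.mul_top hC]
      exact le_top
    by_cases z2 : p.2.2.1 = 0
    · rw [z2, singPow_zero, ENNReal.top_mul (singPow_ne_zero _ _), ENNReal.mul_top (singPow_ne_zero _ _), ENNReal.mul_top (singPow_ne_zero _ _),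
        ENNReal.mul_top hC]
      exact le_top
    by_cases z3 : p.2.2.2 = 0
    · rw [z3, singPow_zero, ENNReal.mul_top (singPow_ne_zero _ _), ENNReal.mul_top (singPow_ne_zero _ _), ENNReal.mul_top (singPow_ne_zero _ _),
        ENNReal.mul_top hC]
      exact le_top
    have hS : 0 < p.2.1 ^ 2 + p.2.2.1 ^ 2 + p.2.2.2 ^ 2 := by positivity
    have hsq : Real.sqrt (p.2.1 ^ 2 + p.2.2.1 ^ 2 + p.2.2.2 ^ 2) ≠ 0 := (Real.sqrt_pos.2 hS).ne'
    rw [singPow_of_ne z0, singPow_of_ne hsq, singPow_of_ne z1, singPow_of_ne z2, singPow_of_ne z3, Real.sq_sqrt hS.le,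
      ← ENNReal.ofReal_mul (Real.rpow_nonneg (sq_nonneg _) _), ← ENNReal.ofReal_mul (Real.rpow_nonneg (sq_nonneg _) _),
      ← ENNReal.ofReal_mul (Real.rpow_nonneg (sq_nonneg _) _), ← ENNReal.ofReal_mul (Real.rpow_nonneg (sq_nonneg _) _),
      ← ENNReal.ofReal_mul (Real.rpow_nonneg (by norm_num) _)]
    refine ENNReal.ofReal_le_ofReal ?_
    have hb := rpow_neg_sum_three_le (p := c₂) (by positivity : 0 < p.2.1 ^ 2) (by positivity : 0 < p.2.2.1 ^ 2)
      (by positivity : 0 < p.2.2.2 ^ 2) hc2.le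
    have h0' : 0 ≤ (p.1 ^ 2) ^ (-c₁) := Real.rpow_nonneg (sq_nonneg _) _
    calc (p.1 ^ 2) ^ (-c₁) * (p.2.1 ^ 2 + p.2.2.1 ^ 2 + p.2.2.2 ^ 2) ^ (-c₂)
        ≤ (p.1 ^ 2) ^ (-c₁) * ((3:ℝ) ^ (-c₂) * ((p.2.1 ^ 2) ^ (-(c₂ / 3)) * (p.2.2.1 ^ 2) ^ (-(c₂ / 3)) * (p.2.2.2 ^ 2) ^ (-(c₂ / 3)))) :=
          mul_le_mul_of_nonneg_left hb h0'
      _ = _ := by ring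
  have hm3 : Measurable fun v : ℝ × ℝ => {u : ℝ | u ^ 2 < 1}.indicator (singPow (c₂ / 3)) v.1 * {u : ℝ | u ^ 2 < 1}.indicator (singPow (c₂ / 3)) v.2 :=
    ((measurable_boxSing _).comp measurable_fst).mul ((measurable_boxSing _).comp measurable_snd)
  have hm2 : Measurable fun u : ℝ × (ℝ × ℝ) => {u : ℝ | u ^ 2 < 1}.indicator (singPow (c₂ / 3)) u.1 *
      ({u : ℝ | u ^ 2 < 1}.indicator (singPow (c₂ / 3)) u.2.1 * {u : ℝ | u ^ 2 < 1}.indicator (singPow (c₂ / 3)) u.2.2) :=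
    ((measurable_boxSing _).comp measurable_fst).mul (hm3.comp measurable_snd)
  have hm1 : Measurable fun p : ℝ × (ℝ × (ℝ × ℝ)) => {u : ℝ | u ^ 2 < 1}.indicator (singPow c₁) p.1 *
      ({u : ℝ | u ^ 2 < 1}.indicator (singPow (c₂ / 3)) p.2.1 * ({u : ℝ | u ^ 2 < 1}.indicator (singPow (c₂ / 3)) p.2.2.1 *
        {u : ℝ | u ^ 2 < 1}.indicator (singPow (c₂ / 3)) p.2.2.2)) :=
    ((measurable_boxSing _).comp measurable_fst).mul (hm2.comp measurable_snd)
  have hI := Ising_lt_top (c := c₂ / 3) (by positivity) hc2'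
  have hI1 := Ising_lt_top (c := c₁) hc1 hc1'
  calc ∫⁻ p, f p ≤ ∫⁻ p : ℝ × (ℝ × (ℝ × ℝ)), ENNReal.ofReal ((3:ℝ) ^ (-c₂)) * ({u : ℝ | u ^ 2 < 1}.indicator (singPow c₁) p.1 *
      ({u : ℝ | u ^ 2 < 1}.indicator (singPow (c₂ / 3)) p.2.1 * ({u : ℝ | u ^ 2 < 1}.indicator (singPow (c₂ / 3)) p.2.2.1 *
        {u : ℝ | u ^ 2 < 1}.indicator (singPow (c₂ / 3)) p.2.2.2))) := lintegral_mono hbd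
    _ = ENNReal.ofReal ((3:ℝ) ^ (-c₂)) * (Ising c₁ * (Ising (c₂ / 3) * (Ising (c₂ / 3) * Ising (c₂ / 3)))) := by
        rw [lintegral_const_mul _ hm1, lintegral_volume_prod_mul (measurable_boxSing _) hm2,
          lintegral_volume_prod_mul (measurable_boxSing _) hm3, lintegral_volume_prod_mul (measurable_boxSing _) (measurable_boxSing _)]
        rfl
    _ < ∞ := ENNReal.mul_lt_top ENNReal.ofReal_lt_top (ENNReal.mul_lt_top hI1 (ENNReal.mul_lt_top hI (ENNReal.mul_lt_top hI hI)))

/-- ★ The cone integral of the two-exponent weight is finite. [folklore] -/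
theorem lintegral_cone_singPow2_lt_top {c₁ c₂ : ℝ} (hc1 : 0 < c₁) (hc1' : 2 * c₁ < 1) (hc2 : 0 < c₂) (hc2' : 2 * (c₂ / 3) < 1) :
    ∫⁻ a, singPow c₁ a.re * singPow c₂ ‖a.im‖ ∂coneMeasure < ∞ := by
  rw [lintegral_coneMeasure_eq]
  exact ENNReal.mul_lt_top ENNReal.ofReal_lt_top (lintegral_ball_singPow2_lt_top hc1 hc1' hc2 hc2')

/-! ## §Q The moment cost at the hub -/

/-- ★ **The moment cost at the hub**: for `0 < ‖a‖ ≤ 1`, `a₀ ≠ 0`, `Im a ≠ 0`, `p ≥ 0`,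
`(4/(α²β⁴))^p·hubK(α,β) ≤ 4^p(π²/12)·(a₀²)^{−(1/3+p)}·(‖Im a‖²)^{−(4/3+2p)}` (`α, β` the axial components of `radialUnit (axisPoint a)`). [folklore] -/
theorem moment_hubK_le {a : ℍ} (ha1 : ‖a‖ ≤ 1) (hre : a.re ≠ 0) (him : a.im ≠ 0) {p : ℝ} (hp : 0 ≤ p) :
    (4 / ((radialUnit (axisPoint a)).re ^ 2 * (radialUnit (axisPoint a)).imI ^ 4)) ^ p *
        hubK (radialUnit (axisPoint a)).re (radialUnit (axisPoint a)).imI ≤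
      4 ^ p * (Real.pi ^ 2 / 12) * ((a.re ^ 2) ^ (-(1/3 + p)) * (‖a.im‖ ^ 2) ^ (-(4/3 + 2 * p))) := by
  obtain ⟨eR, eM⟩ := axisUnit_sq a
  have ha0 : a ≠ 0 := by intro h; rw [h] at hre; exact hre rfl
  have hN : 0 < ‖a‖ ^ 2 := by positivity
  have hR : 0 < a.re ^ 2 := by positivity
  have hM : 0 < ‖a.im‖ ^ 2 := by have := norm_pos_iff.2 him; positivity
  have hN1 : ‖a‖ ^ 2 ≤ 1 := by nlinarith [norm_nonneg a]
  have e4 : (radialUnit (axisPoint a)).imI ^ 4 = ((radialUnit (axisPoint a)).imI ^ 2) ^ 2 := by ring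
  rw [e4, eR, eM]
  -- the ratio is at most `4/(a₀²·(‖Im a‖²)²)`
  have hden : 0 < a.re ^ 2 / ‖a‖ ^ 2 * (‖a.im‖ ^ 2 / ‖a‖ ^ 2) ^ 2 := by positivity
  have hratio : 4 / (a.re ^ 2 / ‖a‖ ^ 2 * (‖a.im‖ ^ 2 / ‖a‖ ^ 2) ^ 2) ≤ 4 / (a.re ^ 2 * (‖a.im‖ ^ 2) ^ 2) := by
    rw [div_le_div_iff₀ hden (by positivity)]
    have e : a.re ^ 2 / ‖a‖ ^ 2 * (‖a.im‖ ^ 2 / ‖a‖ ^ 2) ^ 2 = a.re ^ 2 * (‖a.im‖ ^ 2) ^ 2 / (‖a‖ ^ 2) ^ 3 := by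
      field_simp
    rw [e]
    have h3 : (‖a‖ ^ 2) ^ 3 ≤ 1 := pow_le_one₀ hN.le hN1
    have hX : 0 ≤ 4 * (a.re ^ 2 * (‖a.im‖ ^ 2) ^ 2) := by positivity
    calc 4 * (a.re ^ 2 * (‖a.im‖ ^ 2) ^ 2) = 4 * (a.re ^ 2 * (‖a.im‖ ^ 2) ^ 2) / (‖a‖ ^ 2) ^ 3 * (‖a‖ ^ 2) ^ 3 := by
          field_simp
      _ ≤ 4 * (a.re ^ 2 * (‖a.im‖ ^ 2) ^ 2) / (‖a‖ ^ 2) ^ 3 * 1 := by gcongr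
      _ = 4 * (a.re ^ 2 * (‖a.im‖ ^ 2) ^ 2 / (‖a‖ ^ 2) ^ 3) := by ring
  have hpow : (4 / (a.re ^ 2 / ‖a‖ ^ 2 * (‖a.im‖ ^ 2 / ‖a‖ ^ 2) ^ 2)) ^ p ≤ 4 ^ p * ((a.re ^ 2) ^ (-p) * (‖a.im‖ ^ 2) ^ (-(2 * p))) := by
    refine (Real.rpow_le_rpow (by positivity) hratio hp).trans (le_of_eq ?_)
    rw [Real.div_rpow (by norm_num) (by positivity), Real.mul_rpow hR.le (by positivity), Real.rpow_neg hR.le, Real.rpow_neg hM.le,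
      show ((‖a.im‖ ^ 2) ^ 2) ^ p = (‖a.im‖ ^ 2) ^ (2 * p) by rw [← Real.rpow_natCast (‖a.im‖ ^ 2) 2, ← Real.rpow_mul hM.le]; norm_num]
    field_simp
  have hK := hubK_axis_le ha1 hre him
  have hα : (radialUnit (axisPoint a)).re ≠ 0 := by
    intro h; have : (0:ℝ) < a.re ^ 2 / ‖a‖ ^ 2 := div_pos hR hN; rw [← eR, h] at this; simp at this
  have hβ : (radialUnit (axisPoint a)).imI ≠ 0 := by
    intro h; have : (0:ℝ) < ‖a.im‖ ^ 2 / ‖a‖ ^ 2 := div_pos hM hN; rw [← eM, h] at this; simp at this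
  have hKpos : 0 ≤ hubK (radialUnit (axisPoint a)).re (radialUnit (axisPoint a)).imI := (hubK_pos hα hβ).le
  calc (4 / (a.re ^ 2 / ‖a‖ ^ 2 * (‖a.im‖ ^ 2 / ‖a‖ ^ 2) ^ 2)) ^ p * hubK (radialUnit (axisPoint a)).re (radialUnit (axisPoint a)).imI
      ≤ (4 ^ p * ((a.re ^ 2) ^ (-p) * (‖a.im‖ ^ 2) ^ (-(2 * p)))) * (Real.pi ^ 2 / 12 * ((a.re ^ 2) ^ (-(1/3 : ℝ)) * (‖a.im‖ ^ 2) ^ (-(4/3 : ℝ)))) :=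
        mul_le_mul hpow hK hKpos (by positivity)
    _ = 4 ^ p * (Real.pi ^ 2 / 12) * (((a.re ^ 2) ^ (-p) * (a.re ^ 2) ^ (-(1/3 : ℝ))) * ((‖a.im‖ ^ 2) ^ (-(2 * p)) * (‖a.im‖ ^ 2) ^ (-(4/3 : ℝ)))) := by
        ring
    _ = 4 ^ p * (Real.pi ^ 2 / 12) * ((a.re ^ 2) ^ (-(1/3 + p)) * (‖a.im‖ ^ 2) ^ (-(4/3 + 2 * p))) := by
        rw [← Real.rpow_add hR, ← Real.rpow_add hM]; congr 2 <;> ring_nf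

/-- ★ `⊤`-valued form: `ofReal((4/(α²β⁴))^p·2)·ofReal(hubK) ≤ ofReal(2·4^p·π²/12)·singPow(1/3+p)(a₀)·singPow(4/3+2p)(‖Im a‖)` for `‖a‖ ≤ 1`,
`p ≥ 0` (everywhere: `⊤` on the null set `a₀ = 0 ∨ Im a = 0`). [folklore] -/
theorem ofReal_moment_hubK_le {a : ℍ} (ha1 : ‖a‖ ≤ 1) {p : ℝ} (hp : 0 ≤ p) :
    ENNReal.ofReal ((4 / ((radialUnit (axisPoint a)).re ^ 2 * (radialUnit (axisPoint a)).imI ^ 4)) ^ p * 2) *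
        ENNReal.ofReal (hubK (radialUnit (axisPoint a)).re (radialUnit (axisPoint a)).imI) ≤
      ENNReal.ofReal (2 * 4 ^ p * (Real.pi ^ 2 / 12)) * (singPow (1/3 + p) a.re * singPow (4/3 + 2 * p) ‖a.im‖) := by
  have hCne : ENNReal.ofReal (2 * 4 ^ p * (Real.pi ^ 2 / 12)) ≠ 0 := (ENNReal.ofReal_pos.2 (by positivity)).ne'
  by_cases hre : a.re = 0
  · rw [hre, singPow_zero, ENNReal.top_mul (singPow_ne_zero _ _), ENNReal.mul_top hCne]; exact le_top
  by_cases him : a.im = 0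
  · rw [him, norm_zero, singPow_zero, ENNReal.mul_top (singPow_ne_zero _ _), ENNReal.mul_top hCne]; exact le_top
  rw [singPow_of_ne hre, singPow_of_ne (norm_ne_zero_iff.2 him), ← ENNReal.ofReal_mul (by positivity),
    ← ENNReal.ofReal_mul (Real.rpow_nonneg (sq_nonneg _) _), ← ENNReal.ofReal_mul (by positivity)]
  refine ENNReal.ofReal_le_ofReal ?_
  have h := moment_hubK_le ha1 hre him hp
  have h4 : 0 ≤ (4 / ((radialUnit (axisPoint a)).re ^ 2 * (radialUnit (axisPoint a)).imI ^ 4)) ^ p := Real.rpow_nonneg (by positivity) _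
  nlinarith [h, h4]

end Summit.QuantumFields.YangMills.Theorems.SwapVirialDeficit.ZeroModeSigma

end
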